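import Mathlib
import HarnessLib
import Summits.QuantumFields.YangMills.Theses.ScalingWindowSplit
import Summits.QuantumFields.YangMills.Theorems.MirrorModularBoostsHypercubicLimitCouplingResponseDefsC
import Summits.QuantumFields.YangMills.Theorems.ScalingWindowSplitSelfNormalisedMomentBoundsRStubPlaneMean
import Summits.QuantumFields.YangMills.Theorems.ScalingWindowSplitSelfNormalisedMomentBoundsRStubEventually
import Summits.QuantumFields.YangMills.Theorems.ScalingWindowSplitSelfNormalisedMomentBoundsRStubFlatPoint
import Summits.QuantumFields.YangMills.Theorems.ScalingWindowSplitSelfNormalisedMomentBoundsRStubRiemannBound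
import Summits.QuantumFields.YangMills.Theorems.ScalingWindowSplitSelfNormalisedMomentBoundsRStubAssembly
import Summits.QuantumFields.YangMills.Theorems.ScalingWindowSplitSelfNormalisedMomentBoundsRStubAssemblySlack

/-!
# Crux `SelfNormalisedMomentBoundsR` (stmt-QuantumFields-18014) — line `Sketch`, lead skeleton

Route `ScalingWindowSplit`, crux U_R = `SelfNormalisedMomentBoundsR` (k-uniform plane-resolved `n!`-moment bounds
for the SELF-NORMALISED smeared plaquette fields along every weak-coupling Wilson scheme meeting polynomial
volumes, a past-supported bump `u`, the floor and the window).  Line `Sketch` (crux idea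
`scale-local-normalisation`: Schwartz flatness near the other supports pays for near-coincidence; all inter-scale
running lives in ONE scale-free physics statement), RESHAPED by the lead to its LATTICE form — the smeared field reads
only the values `F(a_k x)`, `x ∈ box 4 L_k`, so the phase-cell decomposition is done on lattice points and needs no
normaliser ratios (the typed (α) of the card divides by `√T⁰(S_{1/ℓ}u)`, which vanishes below the lattice scale).

Registered stubs — gen-1 RESHAPE (2026-08-17, lead c1): the physics stub is SLACKENED at long distance
(`stub_clusterBound` → `stub_clusterBoundSlack`, per-leg kernel `(a_k d)⁻⁴ (1 + a_k d)`; crux disprover g2: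
the pure kernel is too rigid at long range for an asymptotically free `G`, `(g_R/g_1)⁴ ≍ log ξ_phys,k → ∞`) and the
assembly is re-run for the slack kernel (`stub_assembly` p161368 → `stub_assemblySlack`, same constants with `V ↦ 2V`).
Imported (landed): `stub_planeMean` p159510, `stub_eventually` p159318, `stub_flatPoint` p159056, `stub_riemannBound`
p159357, `stub_expansion` p160824, `stub_vertexBound` p160942, `stub_riemannSqrt` p160617, `stub_assembly` p161368.
Landed by gen 1: `stub_assemblySlack` p164581.  The ONLY `sorry` left is the physics stub `stub_clusterBoundSlack`:

* `stub_planeMean` (TRUE, M) — the one-point function of every plane field of a scheme centred by the torus mean of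
  the action density vanishes identically (axis symmetry + translation invariance of Wilson's torus state).
* `stub_clusterBoundSlack` (PHYSICS: the ultraviolet kernel K_UV for simple `G`; FALSE as typed for `G ⊇ U(1) × SU(2)`
  modulo (P1)+(P2) AT SHORT DISTANCE, exactly as the crux by name — landed negative lemmas p163831/p164035) — along every
  admissible datum, eventually in `k`, the canon-normalised centred plaquette correlations at `n ≥ 2` DISTINCT sites of
  the torus obey the functional-graph cluster bound with the per-leg kernel `(a_k d_torus)⁻⁴ (1 + a_k d_torus)`:
  `|c'_kⁿ E_k ∏ᵢ (O_{qᵢ}(τ_{xᵢ}Ũ) − m'_k/6)| ≤ Cⁿ Σ_{f : [n]→[n] fixed-point-free} ∏ᵢ (a_k d(xᵢ, x_{f i}))⁻⁴(1 + a_k d(xᵢ, x_{f i}))`.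
* `stub_flatPoint` (TRUE, S) — pointwise Taylor flatness of a test function at a point outside its support.
* `stub_riemannBound` (TRUE, S) — `a⁴ Σ_{x ∈ Λ} (1 + ‖a x − c‖)⁻⁸ ≤ K` uniformly in `0 < a ≤ 1`, `c`, `Λ ⊆ ℤ⁴`.
* `stub_assemblySlack` (TRUE, L; LANDED p164581) — the discrete phase-cell assembly for the slack kernel: flatness + Riemann
  sums + leaf-stripping over functional graphs + `nⁿ ≤ 3ⁿ n!` turn the one-point identity and the cluster bound at step
  `k` into the crux's bound at step `k`, with constants depending only on the Schwartz order and the volume exponent.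
* `stub_eventually` (TRUE, M) — a bound for `k ≥ k₀` is a bound for all `k` (at fixed `k` at most `(2L_k+1)⁴` of the
  disjointly supported fields are non-zero, each bounded).

`SelfNormalisedMomentBoundsR_of` composes them and concludes the crux BY NAME.
-/

noncomputable section

open scoped SchwartzMap BigOperators Topology
open MeasureTheory Filter Topology
open Literature.MathematicalPhysics.AQFT Literature.MathematicalPhysics.QuantumLattice
open Literature.MathematicalPhysics.QuantumFieldTheory Literature.Probability.LatticeModels
open Summit.QuantumFields.YangMills.Cruxes.HypercubicLimit.CouplingResponse

namespace Summit.QuantumFields.YangMills.Theorems.ScalingWindowSplit.SelfNormalisedMomentBoundsR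

/-! ## Stub 2 — the physics stub: SLACKENED functional-graph cluster bound for the self-normalised scheme -/

/-- **Registered stub `stub_clusterBoundSlack` (line `Sketch`, reshaped gen 1; the ultraviolet kernel).**  At every admissible datum
`(G, r, sch, u, p, M)` of the crux (weak coupling, polynomial volumes, past-supported `u`, floor and window) there are
`C ≥ 1` and `k₀` such that for all `k ≥ k₀`, all `n ≥ 2` and all injective families of sites `x₁ … xₙ` of the box
with plane labels `q₁ … qₙ`, the centred plaquette correlation normalised by `c'_k = 1/√T⁰_k(u,θu)` per insertion obeys
`|c'_kⁿ ∫ ∏ᵢ (O_{qᵢ}(τ_{xᵢ}Ũ) − m'_k/6) dμ_k| ≤ Cⁿ Σ_{f fixed-point-free} ∏ᵢ (a_k d_k(xᵢ, x_{f i}))⁻⁴ (1 + a_k d_k(xᵢ, x_{f i}))`,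
`d_k` the torus distance in lattice units.  Short distance (`a d ≤ 1`): the dimension-4 kernel (free Wick square = sum
over CYCLES of `∏ d⁻⁴`); long distance: one power of SLACK per leg, which covers the infrared running `(g_R/g_1)⁴`
(`≤ 4` for `R ≤ ξ^{1/2}`, `≪ R` beyond) of an asymptotically free `G` along deep-UV schemes (disprover g2,
`stub_clusterBound.md`) and costs the assembly nothing (`stub_assemblySlack`).  This is the crux-by-name residue:
expected for compact SIMPLE `G`, refuted modulo (P1)+(P2) for `U(1) × SU(2)` exactly as the crux itself. [folklore] -/
theorem stub_clusterBoundSlack :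
    ∀ (G : Type) [Group G] [TopologicalSpace G] [IsTopologicalGroup G] [CompactSpace G] [MeasurableSpace G]
      [BorelSpace G] (r : LatticeRep G) (sch : SpeciesScheme (YMSpecies G)) (u : 𝓢(EuclideanSpace ℝ (Fin 4), ℝ))
      (p : ℕ) (M : ℝ),
      let bare : SpeciesScheme (YMSpecies G) := { sch with c := fun _ _ => 1, m := fun _ _ => 0 }
      let T : 𝓢(EuclideanSpace ℝ (Fin 4), ℝ) → ℕ → ℝ := fun w k =>
        latticeSchwinger r.ρ bare (fun s => s.F) k (1 + 1) (fun _ => r.curvature) ![w, thetaTest 4 w] -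
          latticeSchwinger r.ρ bare (fun s => s.F) k 1 (fun _ => r.curvature) ![w] *
            latticeSchwinger r.ρ bare (fun s => s.F) k 1 (fun _ => r.curvature) ![thetaTest 4 w]
      let canon : SpeciesScheme (YMSpecies G) :=
        { sch with
          c := fun _ k => (Real.sqrt (T u k))⁻¹
          m := fun _ k => ∫ U, r.curvature.F (torusLift (sch.side k) U) ∂(wilsonMeasure r.ρ (sch.β k)) }
      sch.HasWeakCouplingLimit →
      (∃ N : ℕ, 1 ≤ N ∧ ∀ᶠ k in atTop, (sch.a k)⁻¹ ≤ (sch.a k * (sch.L k : ℝ)) ^ N) →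
      tsupport u ⊆ {y : EuclideanSpace ℝ (Fin 4) | y 0 < 0} →
      (∀ᶠ k in atTop, (sch.a k) ^ p ≤ T u k ∧ T u k ≤ M * T (timeShiftTest 4 (-1) u) k) →
      ∃ (C : ℝ) (k₀ : ℕ), 1 ≤ C ∧ ∀ k : ℕ, k₀ ≤ k →
        ∀ (n : ℕ) (x : Fin n → Site 4) (q : Fin n → Plane), 2 ≤ n → Function.Injective x →
          (∀ i, x i ∈ box 4 (canon.L k)) →
          |canon.c r.curvature k ^ n *
              ∫ U, ∏ i, ((planeSpecies r (q i)).F (configShift (-(x i)) (torusLift (canon.side k) U)) -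
                canon.m r.curvature k / 6) ∂(wilsonAt r canon k)| ≤
            C ^ n * ∑ f : Fin n → Fin n, (if ∀ i, f i ≠ i then
              ∏ i, (((canon.a k * ‖siteToE (fun μ : Fin 4 =>
                ((((x i μ - x (f i) μ : ℤ) : ZMod (canon.side k)).valMinAbs : ℤ)))‖)⁻¹) ^ 4 *
                (1 + canon.a k * ‖siteToE (fun μ : Fin 4 =>
                  ((((x i μ - x (f i) μ : ℤ) : ZMod (canon.side k)).valMinAbs : ℤ)))‖)) else 0) := by
  sorry

/-! ## The composition: the stubs conclude the crux BY NAME -/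

/-- **`SelfNormalisedMomentBoundsR_of` — the line's composition.**  Fix a datum; the crux's conclusion is
`UniformMomentBoundsPlanes r canon` by `Iff.rfl`.  `stub_clusterBoundSlack` gives `(C, k₀)`; polynomial volumes give
`N`, and `stub_assemblySlack N` (fed `stub_flatPoint`, `stub_riemannBound`) gives `(s, K)`; for `k` beyond `k₀` and
beyond the eventualities `a_k ≤ 1`, `a_k L_k ≥ 1`, `a_k⁻¹ ≤ (a_k L_k)^N` the assembly (with `stub_planeMean` for
the torus-mean-centred scheme `canon`) bounds the moments by `K (K C)ⁿ n!`; `stub_eventually` removes the threshold.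
[folklore] -/
theorem SelfNormalisedMomentBoundsR_of :
    Summit.QuantumFields.YangMills.Theses.ScalingWindowSplit.SelfNormalisedMomentBoundsR := by
  intro G _ _ _ _ _ _ r sch u p M bare T canon hw hpv hu hfw
  show UniformMomentBoundsPlanes r canon
  -- the physics stub at the datum
  obtain ⟨C, k₀, hC1, hcl⟩ := stub_clusterBoundSlack G r sch u p M hw hpv hu hfw
  -- the volume exponent and the assembly constants
  obtain ⟨N, -, hpvN⟩ := hpv
  obtain ⟨s, K, hK, hassem⟩ := stub_assemblySlack stub_flatPoint stub_riemannBound N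
  -- the eventualities of the scheme: `a_k ≤ 1`, `a_k L_k ≥ 1`, polynomial volumes
  have ha1 : ∀ᶠ k in atTop, sch.a k ≤ 1 :=
    (sch.tendsto_a.eventually (Iic_mem_nhds (zero_lt_one' ℝ))).mono fun k hk => hk
  have haL : ∀ᶠ k in atTop, 1 ≤ sch.a k * (sch.L k : ℝ) := sch.tendsto_L.eventually_ge_atTop 1
  obtain ⟨k₁, hk₁⟩ := (ha1.and (haL.and hpvN)).exists_forall_of_atTop
  -- the one-point identity for `canon` (its counterterm IS the torus mean)
  have h1 : ∀ k (q : Plane) (f : 𝓢(EuclideanSpace ℝ (Fin 4), ℝ)),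
      ∫ U, planeField r canon k q f U ∂(wilsonAt r canon k) = 0 :=
    fun k => stub_planeMean G r canon k rfl
  -- assemble on the tail `k ≥ max k₀ k₁`
  refine stub_eventually G r canon ⟨s, max k₀ k₁, K, K * C, fun n F hF hD k hk => ?_⟩
  have hk0 : k₀ ≤ k := (le_max_left _ _).trans hk
  obtain ⟨hak, haLk, hpvk⟩ := hk₁ k ((le_max_right _ _).trans hk)
  exact hassem G r canon k C hC1 hak haLk hpvk (h1 k) (hcl k hk0) n F hF hD

end Summit.QuantumFields.YangMills.Theorems.ScalingWindowSplit.SelfNormalisedMomentBoundsR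

end
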